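import Summits.QuantumFields.BalabanUV.T4Continuum.Support.VariationalColourTaxiTowerEndAvgG
import Summits.QuantumFields.BalabanUV.T4Continuum.Support.VariationalColourTaxiTowerAvgGData
import Summits.QuantumFields.BalabanUV.T4Continuum.Support.VariationalColourTaxiTowerAvgGDecay
import Summits.QuantumFields.BalabanUV.T4Continuum.Support.VariationalColourTaxiTowerAvgGReg
import Summits.QuantumFields.BalabanUV.T4Continuum.Support.VariationalColourTaxiTowerProjGRegularRate

/-!
# T⁴ programme, spine node NE2 (U1a), lane P2 — «V-AVG-G AT TAXI DATA», file 4: THE RATE END AT BAŁABAN's TAXI DATA FOR BAŁABAN's COVARIANT PROJECTED GAUGE FUNCTIONAL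
# WITHOUT ANY SLICE LAW — (G″) «V-AVG-G» AND V-REG′ INHABITED FROM OPERATOR DATA; DISPLAYED: (ONE-min)_k, the regular presentation, the class smallness
# (model level, `E = ℂ`; cell `pub-balaban`)

NE2 formalisation swarm `b2b-balaban-t4-ne2-formalise-*`, leaf prover 10 GEN 5 (`prover-b2b-balaban-t4-ne2-formalise-leaf-10-g5-0`, V-END holder lineage); item
«V-AVG-G AT TAXI DATA» = part 8′ (CLAIMS.log 2026-08-20, ONLINE gen 5), file F4.  Composition BY NAME of file 1 `VariationalColourTaxiTowerEndAvgG.towerLimitRate_effV_taxiTower_avgG_of_class`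
(the END without slice law at taxi data), file 2 `VariationalColourTaxiTowerAvgGData.hAVGG_projG_nestLv` ((G″) from operator data), file 2b `VariationalColourTaxiTowerAvgGDecay.
{epsAvgG_le_of_class, epsAvgG_nonneg}` (its geometric decay), file 3 `VariationalColourTaxiTowerAvgGReg.hREGf_projG_taxi` (V-REG′ by transport), leaf-04-g6's part 8
`VariationalColourTaxiTowerProjGRegularRate.projG_sockets_nestLv` (V-UB ∕ (Går) ∕ V-P ∕ V-REG of `projG` on the tower's carriers) and part 7 `hGdiv_projG_nestLv_regular` ((GF3)_k from a
regular presentation), part 6 `hGF_projG_taxi`, leaf-03-g6's `GmProj_posSemidef` ∕ `projG_eq_qform`, leaf-09-g7's `Gtr_pullback`, leaf-03-g7's `mismatch_twoStepTaxi_class`; nothing defined.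

THE STATEMENT (`towerLimitRate_effV_taxiTower_projG_avgG_of_class`) = part 8's `towerLimitRate_effV_taxiTower_projG_regular_of_class` (p232805's rate twin) WITH THE (SLICE-min) LEAF AND
ITS COSTS `σ, σ′` GONE: hypotheses = part 4's one-step bond data (unitary, plaquette class `(L^{k+1})²b_k ≤ c`, coherent) with the polynomial smallness `hsm1–hsm4` + TWO MORE
(`2d(3(d−1)Lc)² ≤ ½` — the two-step frames' Poincaré class, the ONE L-dependent line; `64d((d−1)c)² ≤ ½` — FED⁺'s mismatch absorption); part 7's DISPLAYED regular presentation of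
`Rlev k` and its two numeric lines; the rate `θ < 1` with `L⁻¹ ≤ θ²` (the half exponent of the harmonic-approximation defect inside (G″) — file 2b); and ONE displayed analytic leaf,
(ONE-min)_k, in parts 6–8's VERBATIM binder shape with a GENERIC V-REG size `ρV` (+ its V-REG `hREG`), so that leaf-04-g7's `VariationalColourTaxiTowerCentred.hONEm_taxi` (p238755:
(ONE-min) with background at taxi data, `ρV := ScV + nsqV∘Q`, V-REG at `C_R = 1`) plugs in unchanged.  Conclusion: `TowerLimitRate` for `effV (L^k) M (Rlev k) (GmProj …) (QmL (nestLv k)) aa`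
at rate `θ` with the constant `eV Λ⋆ (C_P⋆ + CR′⋆) (c_δ + C_ε″) + ePV Λ⋆ C_P⋆ C_R,one c_ε c_δ′` — `Λ⋆, C_P⋆, κ⋆, κ⋆′, C_D, C_D′, R⋆, C_Rv⋆` part 8's, `CR′⋆ = C_Rv⋆ + κ⋆ + κ⋆′ + C_P⋆ +
C_D + C_D′` (file 3), `c_δ = 2d(dc + Lc)`, `C_ε″` file 2b's — all written out as a `let` telescope.
INSIDE: the class package gives the level plaquette bounds; part 7 gives (GF3)_k; `projG_sockets_nestLv` gives the G-side sockets at EVERY level, used at `k` for the END's own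
sockets and at `k+1` for V-REG′ (file 3); the four per-level smallness numbers of file 2 are the class lines `hsmallP` (package), `hsm2`, the new `hsm6`, and `hsm5` via
`mismatch_twoStepTaxi_class`; the (G″) defect `ε″_k` and the regularity functional `ρ′_k` are NOT written here — they are file 2's `let` telescope, fixed by unification.
WHAT THIS CLOSES (located, model level): with p238755 the vector END WITH RATE at Bałaban's taxi data for Bałaban's covariant `projG` has NO displayed analytic leaf of the LOWER
bracket (no slice law, no (SLICE-min), no σ-type constant) and the UPPER bracket's (ONE-min) has a kernel supplier; what stays displayed are CLASS ∕ PRESENTATION hypotheses on the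
data and numeric smallness.  NOT CLAIMED: anything about Bałaban's minimisers ∕ `R_k(U)` (c5); the thresholds are quantitatively void (memo GF3COV §3); the rate is `θ ≥ L^{−1∕2}`.

HONEST FRAMING (T4-DAG p. 1).  Model level (`E = ℂ`; bond operators DATA; taxi ∕ straight contours and the straight-taxi gauge fixing OURS; SHAPES only; no B0, c5); composition
of landed files; nothing printed is a hypothesis; no `def`, no `def … : Prop`, no `sorry`; axioms standard.  (ONE-min)_k and the regular presentation DISPLAYED ⟹ this file alone
discharges no END with background; V-END with background ∕ NE2 NOT proved here; NE3 OPEN; spine PROVED 0∕9 unchanged; rung (B)+1 on a fixed finite T⁴ — NOT infinite volume, NOT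
mass gap, NOT Clay.  HONEST DEPENDENCY (cell, verbatim): continuum YM on T⁴ ⇐ BetaPertH ∧ nine spine estimates (0/9 proved); BetaPertH ⇐ (D1) ∧ (D4) ∧ CAP+tail; G-an2-4 gates
asym, D1 and NE2/3/4.
-/

noncomputable section

namespace Summit.QuantumFields.BalabanUV.T4Continuum.VariationalColourTaxiTowerProjGAvgGRate

open Finset
open scoped Matrix ComplexOrder BigOperators
open Literature.MathematicalPhysics.QuantumFieldTheory.Balaban1983to89.B5Prop11Plancherel (Tor fine unitVec Cst)
open Literature.MathematicalPhysics.QuantumFieldTheory.Balaban1983to89.B5Composition116 (sites)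
open Literature.Analysis.Complex (qform)
open Summit.QuantumFields.BalabanUV.T4Continuum.VariationalColourFederbush (norm_le_one_of_mem_unitary)
open Summit.QuantumFields.BalabanUV.T4Continuum.VariationalColourTower (Rtrv)
open Summit.QuantumFields.BalabanUV.T4Continuum.VariationalColourTaxiTransport
open Summit.QuantumFields.BalabanUV.T4Continuum.VariationalVectorFederbush (lineT)
open Summit.QuantumFields.BalabanUV.T4Continuum.CovariantAveragingTower (TowerLimitRate)
open Summit.QuantumFields.BalabanUV.T4Continuum.VectorBlockTrialForm (nsqV nsqV_nonneg QvL roughV kappaV)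
open Summit.QuantumFields.BalabanUV.T4Continuum.VariationalVectorForm (ScV SfV qWV qVV lamV lamV_nonneg ScV_nonneg)
open Summit.QuantumFields.BalabanUV.T4Continuum.VariationalVectorEffective (unc effV)
open Summit.QuantumFields.BalabanUV.T4Continuum.VariationalVectorTower (Gtr QmL)
open Summit.QuantumFields.BalabanUV.T4Continuum.VariationalVectorEndOfLeaves (eV ePV)
open Summit.QuantumFields.BalabanUV.T4Continuum.VariationalVectorWeitzenbock (divSq)
open Summit.QuantumFields.BalabanUV.T4Continuum.VariationalVectorGaugeSlice (avgOp projG projG_nonneg)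
open Summit.QuantumFields.BalabanUV.T4Continuum.VariationalVectorGaugeSliceTower (Gtr_pullback)
open Summit.QuantumFields.BalabanUV.T4Continuum.VariationalVectorRegularityCovariant (GmProj GmProj_posSemidef projG_eq_qform)
open Summit.QuantumFields.BalabanUV.T4Continuum.SliceComplementFlatGap (deltaGap)
open Summit.QuantumFields.BalabanUV.T4Continuum.CompositeFibreMismatch (mismatch_twoStepTaxi_class)
open Summit.QuantumFields.BalabanUV.T4Continuum.VariationalColourTaxiTowerEndAvgG (towerLimitRate_effV_taxiTower_avgG_of_class)
open Summit.QuantumFields.BalabanUV.T4Continuum.VariationalColourTaxiTowerAvgGData (hAVGG_projG_nestLv)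
open Summit.QuantumFields.BalabanUV.T4Continuum.VariationalColourTaxiTowerAvgGDecay (epsAvgG_le_of_class epsAvgG_nonneg)
open Summit.QuantumFields.BalabanUV.T4Continuum.VariationalColourTaxiTowerAvgGReg (hREGf_projG_taxi)

variable {d : ℕ}
variable (L : ℕ) [NeZero L] (M : Fin d → ℕ) [hM : ∀ μ, NeZero (M μ)]
variable {R' : (k : ℕ) → Tor (fine L (fine (L ^ k) M)) → Fin d → (ℂ →L[ℂ] ℂ)}

/-- **THE VECTOR END WITH RATE AT BAŁABAN's TAXI DATA FOR BAŁABAN's COVARIANT PROJECTED GAUGE FUNCTIONAL, NO SLICE LAW: (G″) AND V-REG′ INHABITED, ONLY (ONE-min)_k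
DISPLAYED.**  File 1's `towerLimitRate_effV_taxiTower_avgG_of_class` for `G k := projG (Rlev k) (ker Q_{taxiTv (Rlev k)})` with the G-side INHABITED (matrix form `GmProj`, pullback
`Gtr`, (GF1′) `C_G = d, C₀ = 0`, (Går) ∕ V-P ∕ V-REG from part 8's `projG_sockets_nestLv` over part 7's (GF3)_k), `hAVGG` := file 2 (operator data + the coefficient-one kernel
swap; decay file 2b, `θ² ≥ L⁻¹`), `hREGf` := file 3 (transport of the level-(k+1) sockets); DISPLAYED: the data classes (one-step plaquette class + six polynomial smallness lines,
regular presentation + two numeric lines) and the ONE analytic leaf (ONE-min)_k with geometric costs and a generic V-REG size `ρV`. [folklore] -/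
theorem towerLimitRate_effV_taxiTower_projG_avgG_of_class (hL : 2 ≤ L) (hd : 1 ≤ d) (hM2 : ∀ μ, 1 < M μ)
    -- the one-step bond data: unitary, plaquette class, coherent
    (hU : ∀ k x μ, R' k x μ ∈ unitary (ℂ →L[ℂ] ℂ)) {b : ℕ → ℝ} {c : ℝ}
    (hb : ∀ k x κ ι, ‖R' k x κ * R' k (x + unitVec (fine L (fine (L ^ k) M)) κ) ι - R' k x ι * R' k (x + unitVec (fine L (fine (L ^ k) M)) ι) κ‖ ≤ b k)
    (hbc : ∀ k, (((L ^ (k + 1) : ℕ)) : ℝ) ^ 2 * b k ≤ c)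
    (hcoh : ∀ k, coarseTv L (fine (L ^ (k + 1)) M) (R' (k + 1)) = Rtrv (L ^ k) L M (R' k))
    -- the polynomial smallness of the class constant (parts 6–8's four + the two-step frames' class + FED⁺'s absorption)
    (hsm1 : 60 * (6 : ℝ) ^ (d - 1) * ((2 * ((((d - 1 : ℕ) : ℝ) + (d : ℝ) * d)) + 3 * ((d - 1 : ℕ) : ℝ)) * c) ≤ 1 / 2)
    (hsm2 : 2 * (d : ℝ) * ((((d - 1 : ℕ) : ℝ)) * c) ^ 2 ≤ 1 / 2) (hsm3 : 64 * (2 * ((((d - 1 : ℕ) : ℝ) + (d : ℝ) * d) * c)) ^ 2 ≤ 1)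
    (hsm4 : 80 * ((d : ℝ) * c) ≤ 1) (hsm5 : 2 * (d : ℝ) * (3 * ((d - 1 : ℕ) : ℝ) * L * c) ^ 2 ≤ 1 / 2) (hsm6 : 64 * (d : ℝ) * ((((d - 1 : ℕ) : ℝ)) * c) ^ 2 ≤ 1 / 2)
    -- the DISPLAYED regular presentation of the tower's unit-lattice bond fields and the numeric smallness replacing (GF3)
    {ar ℓr : ℕ → ℝ} {α lam : ℝ} (har0 : ∀ k, 0 ≤ ar k) (har : ∀ k x μ, ‖Rlev L M R' k x μ - 1‖ ≤ ar k)
    (hℓr : ∀ k x μ, ‖Rlev L M R' k x μ - Rlev L M R' k (x - unitVec (fine (L ^ k) M) μ) μ‖ ≤ ℓr k)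
    (hα : ∀ k, (((L ^ k : ℕ)) : ℝ) * ar k ≤ α) (hlam : ∀ k, (((L ^ k : ℕ)) : ℝ) ^ 2 * ℓr k ≤ lam)
    (hsmallδ : (18 * (d * ((d + 1 : ℝ) * Cst d 1)) + 6) * deltaGap d 1 α lam (d * α) (((d - 1 : ℕ) : ℝ) * c) ^ 2 ≤ 1 / 2)
    (hsmallQ : ((d + 1 : ℝ) * Cst d 1) * (7 * (d * α ^ 2) + 2 * (2 * ((((d - 1 : ℕ) : ℝ) + (d : ℝ) * d) * c) + (d * α + α)) ^ 2) ≤ 1 / 2)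
    -- the effective-operator parameter and the rate (`θ² ≥ L⁻¹`: the half exponent of the harmonic-approximation defect inside (G″))
    {aa : ℝ} (haa : 0 < aa) {θ : ℝ} (hθ0 : 0 ≤ θ) (hθL : (L : ℝ)⁻¹ ≤ θ ^ 2) (hθ1 : θ < 1)
    -- the ONE displayed analytic leaf: (ONE-min)_k for the FULL fine form, with a generic V-REG size `ρV` and its V-REG
    (CR ε₁ δ' : ℕ → ℝ) {CRone cε cδ' : ℝ} (hCR : ∀ k, 0 ≤ CR k) (hCRs : ∀ k, CR k ≤ CRone) (hε₁ : ∀ k, 0 ≤ ε₁ k) (hδ' : ∀ k, 0 ≤ δ' k)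
    (hεθ : ∀ k, ε₁ k ≤ cε * θ ^ k) (hδ'θ : ∀ k, δ' k ≤ cδ' * θ ^ k)
    {ρV : (k : ℕ) → (Tor (fine (L ^ k) M) → Fin d → ℂ) → ℝ} (hρ0 : ∀ k W, 0 ≤ ρV k W)
    (hONEm : ∀ k (φ : Tor M → Fin d → ℂ) (W₀ : Tor (fine (L ^ k) M) → Fin d → ℂ), QvL (L ^ k) M (nestLv L M R' k) W₀ = φ →
      (∀ W, QvL (L ^ k) M (nestLv L M R' k) W = φ → ScV (L ^ k) M (Rlev L M R' k) (projG (fine (L ^ k) M) (Rlev L M R' k) (LinearMap.ker (avgOp (L ^ k) M (taxiTv (L ^ k) M (Rlev L M R' k))))) W₀ ≤ ScV (L ^ k) M (Rlev L M R' k) (projG (fine (L ^ k) M) (Rlev L M R' k) (LinearMap.ker (avgOp (L ^ k) M (taxiTv (L ^ k) M (Rlev L M R' k))))) W) →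
      ∃ g, QvL (L ^ k) M (nestLv L M R' k) (QvL L (fine (L ^ k) M) (lineT L (fine (L ^ k) M) (taxiTv L (fine (L ^ k) M) (R' k)) (R' k)) g) = φ ∧
        SfV (L ^ k) L M (R' k) (fun W' => (projG (fine (L ^ (k + 1)) M) (Rlev L M R' (k + 1)) (LinearMap.ker (avgOp (L ^ (k + 1)) M (taxiTv (L ^ (k + 1)) M (Rlev L M R' (k + 1)))))) (W' ∘ sites (L ^ k) L M)) g ≤ (Real.sqrt (ScV (L ^ k) M (Rlev L M R' k) (projG (fine (L ^ k) M) (Rlev L M R' k) (LinearMap.ker (avgOp (L ^ k) M (taxiTv (L ^ k) M (Rlev L M R' k))))) W₀ + ε₁ k * ρV k W₀) + δ' k * Real.sqrt (qWV (L ^ k) M W₀)) ^ 2)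
    (hREG : ∀ k (φ : Tor M → Fin d → ℂ) W, QvL (L ^ k) M (nestLv L M R' k) W = φ →
      (∀ W₂, QvL (L ^ k) M (nestLv L M R' k) W₂ = φ → ScV (L ^ k) M (Rlev L M R' k) (projG (fine (L ^ k) M) (Rlev L M R' k) (LinearMap.ker (avgOp (L ^ k) M (taxiTv (L ^ k) M (Rlev L M R' k))))) W ≤ ScV (L ^ k) M (Rlev L M R' k) (projG (fine (L ^ k) M) (Rlev L M R' k) (LinearMap.ker (avgOp (L ^ k) M (taxiTv (L ^ k) M (Rlev L M R' k))))) W₂) →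
      ρV k W ≤ CR k * (ScV (L ^ k) M (Rlev L M R' k) (projG (fine (L ^ k) M) (Rlev L M R' k) (LinearMap.ker (avgOp (L ^ k) M (taxiTv (L ^ k) M (Rlev L M R' k))))) W + nsqV M φ)) :
    -- the constants: part 8's G-side constants, file 3's V-REG′ sum, file 2b's (G″) decay constant
    let CDs : ℝ := 36 * (d * ((d + 1 : ℝ) * Cst d 1)) + 8
    let CDs' : ℝ := 24 * (d * ((d + 1 : ℝ) * Cst d 1)) + 4
    let Λs : ℝ := 4 * lamV d (((d - 1 : ℕ) : ℝ) * c) (d : ℝ) 0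
    let κs : ℝ := 2 * (1 + CDs)
    let κs' : ℝ := 2 * (CDs' + (d : ℝ) * c * 64)
    let CPs : ℝ := max (40 * κs) (64 + 40 * κs')
    let RPs : ℝ := 4 * d * (36 : ℝ) ^ d * (1 + ((d - 1 : ℕ) : ℝ) * c) ^ 2
    let CRvs : ℝ := 8 * Λs + 2 * d * c * (κs + κs') + (8 * RPs ^ 2 + 5 * (d : ℝ) ^ 2 * c ^ 2) * CPs
    let CRs' : ℝ := CRvs + κs + κs' + CPs + CDs + CDs'
    let Λcs : ℝ := 2 * d * (36 : ℝ) ^ d * ((4 + ((d - 1 : ℕ) : ℝ) * c) ^ 2 + 9)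
    let CRHs : ℝ := 2 * Λcs + 2 * d * c + (d : ℝ) ^ 2 * c ^ 2 * 136
    let ε₁s : ℝ := ((d : ℝ) / 4 + 1 / 2) * L
    let δ's : ℝ := Real.sqrt (2 * d * (1 + (d : ℝ) ^ 2)) * (2 * ((d - 1 : ℕ) : ℝ) * L * c)
    let ΛHs : ℝ := Λcs + (ε₁s * CRHs + 2 * δ's * Real.sqrt ((1 + ε₁s * CRHs) * 136) + δ's ^ 2 * 136) * (Λcs + 1)
    let EHs : ℝ := ePV ΛHs 136 CRHs ε₁s δ's + eV ΛHs 136 (Real.sqrt d * (((d - 1 : ℕ) : ℝ) * c))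
    let Cε : ℝ := Real.sqrt (3 * d) * (2 + 2 * (((d - 1 : ℕ) : ℝ) * c)) + Real.sqrt (136 * EHs) + 4 * (d : ℝ) ^ 2 * c * RPs
    TowerLimitRate (ι := fun _ => Tor M × Fin d) (fun _ => (1 : Matrix (Tor M × Fin d) (Tor M × Fin d) ℂ)) 1
      (fun k => effV (L ^ k) M (Rlev L M R' k)
        (GmProj (fine (L ^ k) M) (Rlev L M R' k) (LinearMap.ker (avgOp (L ^ k) M (taxiTv (L ^ k) M (Rlev L M R' k))))) (QmL (L ^ k) M (nestLv L M R' k)) aa)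
      (eV Λs (CPs + CRs') (2 * d * ((d : ℝ) * c + L * c) + Cε) + ePV Λs CPs CRone cε cδ') θ := by
  intro CDs CDs' Λs κs κs' CPs RPs CRvs CRs' Λcs CRHs ε₁s δ's ΛHs EHs Cε
  have hL1 : 1 ≤ L := le_trans (by norm_num) hL
  have hθ1' : θ ≤ 1 := hθ1.le
  have hθL' : (L : ℝ)⁻¹ ≤ θ := hθL.trans (pow_le_of_le_one hθ0 hθ1' two_ne_zero)
  have hd0 : (0 : ℝ) ≤ d := Nat.cast_nonneg d
  have hD0 : (0 : ℝ) ≤ ((d - 1 : ℕ) : ℝ) := Nat.cast_nonneg _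
  have hCst := Literature.MathematicalPhysics.QuantumFieldTheory.Balaban1983to89.B5Prop11Lower.one_le_Cst (d := d) (1 : ℝ)
  have hCDs0 : (0 : ℝ) ≤ CDs := by show (0 : ℝ) ≤ 36 * (d * ((d + 1 : ℝ) * Cst d 1)) + 8; positivity
  have hCDs0' : (0 : ℝ) ≤ CDs' := by show (0 : ℝ) ≤ 24 * (d * ((d + 1 : ℝ) * Cst d 1)) + 4; positivity
  have hb0 : ∀ k, 0 ≤ b k := fun k => (norm_nonneg _).trans (hb k 0 ⟨0, hd⟩ ⟨0, hd⟩)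
  -- the class package (plaquette bounds of `Rlev k`, the smallness lines, `Λ_k ≤ Λ⋆`) with the (GF1′) constants of `projG`: `C_G = d`, `C₀ = 0`
  obtain ⟨a, ha0, ha, hac, hκγ, hsmallP, hγs, -, hΛk⟩ := taxiClassPackage L M hL hd hU hb hbc hsm1 hsm2 hsm3 (CG := fun _ => (d : ℝ)) (C₀ := fun _ => 0)
    (CGs := (d : ℝ)) (c₀ := 0) (fun _ => Nat.cast_nonneg d) (fun _ => le_rfl) (fun _ => le_rfl) (fun _ => by simp)
  have hc0 : 0 ≤ c := le_trans (by have := ha0 0; positivity) (hac 0)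
  -- (GF3) at every level, SUPPLIED by part 7
  have hGdiv : ∀ k W, ((((L ^ k : ℕ) : ℝ)) ^ d)⁻¹ * ((((L ^ k : ℕ) : ℝ)) ^ 2 * divSq (fine (L ^ k) M) (Rlev L M R' k) W)
      ≤ CDs * ScV (L ^ k) M (Rlev L M R' k) (projG (fine (L ^ k) M) (Rlev L M R' k) (LinearMap.ker (avgOp (L ^ k) M (taxiTv (L ^ k) M (Rlev L M R' k))))) W
        + CDs' * nsqV M (QvL (L ^ k) M (nestLv L M R' k) W) := fun k W =>
    hGdiv_projG_nestLv_regular L M hL hU hb hbc hcoh hd hM2 k (ha0 k) (ha k) (hac k) (har0 k) (har k) (hℓr k) (hα k) (hlam k) hsmallδ hsmallQ W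
  -- the G-side sockets at EVERY level (part 8)
  obtain ⟨-, hGar, hPc, hREGv⟩ := projG_sockets_nestLv L M hd hM2 hU hb hcoh ha0 ha hac hκγ hsmallP hγs hΛk hsm4 hCDs0 hCDs0' hGdiv
  -- the four per-level smallness numbers of file 2: the package line, `hsm2`, `hsm6`, `hsm5`
  have hL0 : (0 : ℝ) ≤ L := Nat.cast_nonneg L
  have hL1r : ((L - 1 : ℕ) : ℝ) ≤ L := by exact_mod_cast Nat.sub_le L 1
  have hLk1 : ∀ k : ℕ, (1 : ℝ) ≤ ((L ^ k : ℕ) : ℝ) := fun k => by exact_mod_cast Nat.one_le_pow k L hL1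
  have hLLb : ∀ k, (L : ℝ) * L * b k ≤ c := fun k => by
    have h1 : (L : ℝ) * L ≤ (((L ^ (k + 1) : ℕ)) : ℝ) ^ 2 := by
      have e : (((L ^ (k + 1) : ℕ)) : ℝ) = ((L ^ k : ℕ) : ℝ) * L := by push_cast; ring
      rw [e]
      calc (L : ℝ) * L = 1 * ((L : ℝ) * L) := by ring
        _ ≤ ((L ^ k : ℕ) : ℝ) ^ 2 * ((L : ℝ) * L) := mul_le_mul_of_nonneg_right (one_le_pow₀ (hLk1 k)) (by positivity)
        _ = (((L ^ k : ℕ) : ℝ) * L) ^ 2 := by ring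
    exact (mul_le_mul_of_nonneg_right h1 (hb0 k)).trans (hbc k)
  have hsmall₁ : ∀ k, 2 * (d : ℝ) * ((L : ℝ) * (((d - 1 : ℕ) : ℝ) * ((L - 1 : ℕ) : ℝ) * b k)) ^ 2 ≤ 1 / 2 := fun k => by
    have hX0 : 0 ≤ (L : ℝ) * (((d - 1 : ℕ) : ℝ) * ((L - 1 : ℕ) : ℝ) * b k) := by have := hb0 k; positivity
    have hX : (L : ℝ) * (((d - 1 : ℕ) : ℝ) * ((L - 1 : ℕ) : ℝ) * b k) ≤ ((d - 1 : ℕ) : ℝ) * c := by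
      have := hb0 k
      calc (L : ℝ) * (((d - 1 : ℕ) : ℝ) * ((L - 1 : ℕ) : ℝ) * b k) = ((d - 1 : ℕ) : ℝ) * ((L : ℝ) * ((L - 1 : ℕ) : ℝ) * b k) := by ring
        _ ≤ ((d - 1 : ℕ) : ℝ) * ((L : ℝ) * L * b k) :=
            mul_le_mul_of_nonneg_left (mul_le_mul_of_nonneg_right (mul_le_mul_of_nonneg_left hL1r hL0) this) hD0
        _ ≤ ((d - 1 : ℕ) : ℝ) * c := mul_le_mul_of_nonneg_left (hLLb k) hD0
    have h2 := pow_le_pow_left₀ hX0 hX 2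
    exact (mul_le_mul_of_nonneg_left h2 (by positivity)).trans hsm2
  have habsorb : ∀ k, 64 * (d : ℝ) * ((((L ^ k : ℕ) : ℝ)) * (((d - 1 : ℕ) : ℝ) * L * ((L - 1 : ℕ) : ℝ) * b k)) ^ 2 ≤ 1 / 2 := fun k => by
    have hY0 : 0 ≤ (((L ^ k : ℕ) : ℝ)) * (((d - 1 : ℕ) : ℝ) * L * ((L - 1 : ℕ) : ℝ) * b k) := by have := hb0 k; positivity
    have hY : (((L ^ k : ℕ) : ℝ)) * (((d - 1 : ℕ) : ℝ) * L * ((L - 1 : ℕ) : ℝ) * b k) ≤ ((d - 1 : ℕ) : ℝ) * c := by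
      have hb' := hb0 k
      have hN := hLk1 k
      have h1 : (((L ^ k : ℕ) : ℝ)) * ((L : ℝ) * L * b k) ≤ c := by
        have e : (((L ^ (k + 1) : ℕ)) : ℝ) = ((L ^ k : ℕ) : ℝ) * L := by push_cast; ring
        have h2 := hbc k
        rw [e] at h2
        nlinarith [mul_nonneg (mul_nonneg (sub_nonneg.2 hN) (le_trans zero_le_one hN)) (by positivity : (0 : ℝ) ≤ (L : ℝ) * L * b k)]
      calc (((L ^ k : ℕ) : ℝ)) * (((d - 1 : ℕ) : ℝ) * L * ((L - 1 : ℕ) : ℝ) * b k)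
          = ((d - 1 : ℕ) : ℝ) * ((((L ^ k : ℕ) : ℝ)) * ((L : ℝ) * ((L - 1 : ℕ) : ℝ) * b k)) := by ring
        _ ≤ ((d - 1 : ℕ) : ℝ) * ((((L ^ k : ℕ) : ℝ)) * ((L : ℝ) * L * b k)) :=
            mul_le_mul_of_nonneg_left (mul_le_mul_of_nonneg_left (mul_le_mul_of_nonneg_right (mul_le_mul_of_nonneg_left hL1r hL0) hb') (le_trans zero_le_one hN)) hD0
        _ ≤ ((d - 1 : ℕ) : ℝ) * c := mul_le_mul_of_nonneg_left h1 hD0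
    have h2 := pow_le_pow_left₀ hY0 hY 2
    exact (mul_le_mul_of_nonneg_left h2 (by positivity)).trans hsm6
  have hsmallcp : ∀ k, 2 * (d : ℝ) * ((((L ^ k * L : ℕ) : ℝ))
      * (((d - 1 : ℕ) : ℝ) * ((L - 1 : ℕ) : ℝ) * ((2 * L - 1 : ℕ) : ℝ) * b k + ((d - 1 : ℕ) : ℝ) * ((L ^ k - 1 : ℕ) : ℝ) * a k)) ^ 2 ≤ 1 / 2 := fun k => by
    have hZ0 : 0 ≤ (((L ^ k * L : ℕ) : ℝ)) * (((d - 1 : ℕ) : ℝ) * ((L - 1 : ℕ) : ℝ) * ((2 * L - 1 : ℕ) : ℝ) * b k + ((d - 1 : ℕ) : ℝ) * ((L ^ k - 1 : ℕ) : ℝ) * a k) := by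
      have := hb0 k; have := ha0 k; positivity
    have hZ := mismatch_twoStepTaxi_class (d := d) L k hL1 (hb0 k) (ha0 k) (hbc k) (hac k)
    have h2 := pow_le_pow_left₀ hZ0 hZ 2
    exact (mul_le_mul_of_nonneg_left h2 (by positivity)).trans hsm5
  -- nonnegativity of the G-side constants
  have hdc0 : (0 : ℝ) ≤ (d : ℝ) * c * 64 := by positivity
  have hκs0 : (0 : ℝ) ≤ κs := mul_nonneg zero_le_two (add_nonneg zero_le_one hCDs0)
  have hκs0' : (0 : ℝ) ≤ κs' := mul_nonneg zero_le_two (add_nonneg hCDs0' hdc0)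
  have hΛs0 : 0 ≤ Λs := mul_nonneg (by norm_num) (lamV_nonneg (Nat.cast_nonneg d) (by positivity))
  have hCPs0 : 0 ≤ CPs := le_max_of_le_left (mul_nonneg (by norm_num) hκs0)
  have hRPs0 : 0 ≤ RPs := by show (0 : ℝ) ≤ 4 * d * (36 : ℝ) ^ d * (1 + ((d - 1 : ℕ) : ℝ) * c) ^ 2; positivity
  have hd2c2 : (0 : ℝ) ≤ 5 * (d : ℝ) ^ 2 * c ^ 2 := by positivity
  have hCRvs0 : 0 ≤ CRvs :=
    add_nonneg (add_nonneg (mul_nonneg (by norm_num) hΛs0) (mul_nonneg (mul_nonneg (mul_nonneg zero_le_two hd0) hc0) (add_nonneg hκs0 hκs0')))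
      (mul_nonneg (add_nonneg (mul_nonneg (by norm_num) (sq_nonneg RPs)) hd2c2) hCPs0)
  have hCRs'0 : 0 ≤ CRs' := add_nonneg (add_nonneg (add_nonneg (add_nonneg (add_nonneg hCRvs0 hκs0) hκs0') hCPs0) hCDs0) hCDs0'
  -- the END of file 1, fed
  exact towerLimitRate_effV_taxiTower_avgG_of_class L M
    (fun k => GmProj (fine (L ^ k) M) (Rlev L M R' k) (LinearMap.ker (avgOp (L ^ k) M (taxiTv (L ^ k) M (Rlev L M R' k)))))
    (fun k => (projG (fine (L ^ k) M) (Rlev L M R' k) (LinearMap.ker (avgOp (L ^ k) M (taxiTv (L ^ k) M (Rlev L M R' k))))))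
    (fun k => fun W' => (projG (fine (L ^ (k + 1)) M) (Rlev L M R' (k + 1)) (LinearMap.ker (avgOp (L ^ (k + 1)) M (taxiTv (L ^ (k + 1)) M (Rlev L M R' (k + 1)))))) (W' ∘ sites (L ^ k) L M))
    hL hd hM2 hU hb hbc hcoh hsm1 hsm2 hsm3
    (fun k => GmProj_posSemidef _ _ _) (fun k W => projG_eq_qform _ _ _ W)
    (fun k => (Gtr_pullback (L ^ k) L M ((projG (fine (L ^ (k + 1)) M) (Rlev L M R' (k + 1)) (LinearMap.ker (avgOp (L ^ (k + 1)) M (taxiTv (L ^ (k + 1)) M (Rlev L M R' (k + 1)))))))).symm)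
    (CG := fun _ => (d : ℝ)) (C₀ := fun _ => 0) (CGs := (d : ℝ)) (c₀ := 0) (κg := fun _ => κs) (κs := κs) (κg' := fun _ => κs') (κs' := κs')
    (fun _ => Nat.cast_nonneg d) (fun _ => le_rfl) (fun _ => le_rfl) (fun _ => by simp) (fun _ => hκs0') (fun _ => le_rfl) (fun _ => le_rfl)
    (fun k W => hGF_projG_taxi L M hU k _ W) hGar haa hθL' hθ1
    (fun _ => CRs') _ (fun _ => hCRs'0) (fun _ => le_rfl)
    (fun k => epsAvgG_nonneg L (a := a) hb0 k) (fun k => epsAvgG_le_of_class L hL hd ha0 hb0 hac hbc hθ0 hθ1' hθL k)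
    (fun k φ g₀ _ _ => hAVGG_projG_nestLv L M hM2 hU hb0 ha0 hb ha hcoh hsmallP hsmall₁ habsorb hsmallcp k g₀)
    (fun k φ g hg hmin => hREGf_projG_taxi L M k hκs0 hκs0' hCDs0 hCDs0' (hREGv (k + 1)) (hGar (k + 1)) (hPc (k + 1)) (hGdiv (k + 1)) φ g hg hmin)
    CR ε₁ δ' hCR hCRs hε₁ hδ' hεθ hδ'θ hρ0 hONEm hREG

end Summit.QuantumFields.BalabanUV.T4Continuum.VariationalColourTaxiTowerProjGAvgGRate

end
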